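import Mathlib
import Summits.Ventures.PercRepro.PuncturedLYMMixP1Q2Count
import Summits.Ventures.PercRepro.PuncturedLYMMixP1Q2PosMain1

/-!
# PercRepro — (SP) FOR `1` PAIRWISE DISJOINT PAIRS AND `2` PAIRWISE DISJOINT QUADRUPLES AT LEVEL `4`: THE WEIGHT FUNCTION
(p10, gen 41)

`wdir` = the table entry of the instance under the guard (`1/2` / `1/4` at the member-column codes `1` / `5`), `W` = its lift
to a weight on (row type, free count, direction) normalised by `#Y`; nonnegativity.  Nothing here asserts (SP).
-/

namespace PercRepro.PuncturedLYM.Split.TypeLift.MixP1Q2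

open Finset

/-- The weight of a row class towards a direction code `v` (`1`: the last point of a pair met in `1` points, `5`: the last
point of a quadruple met in `3` points — member columns; otherwise the table entry under the guard that the class is realised by a
row of an instance with `n ≥ 10` points and enough free points). -/
def wdir (n : ℚ) (c21 c41 c42 c43 v : ℕ) : ℚ :=
  if v = 1 then 1 / 2 else if v = 5 then 1 / 4 else
  if 10 ≤ n ∧ (4 : ℚ) - c21 - c41 - 2 * c42 - 3 * c43 ≤ n - 10 then raw n c21 c41 c42 c43 v else 0

/-- The weights are nonnegative. -/
theorem wdir_nonneg (n : ℚ) (c21 c41 c42 c43 v : ℕ) : 0 ≤ wdir n c21 c41 c42 c43 v := by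
  unfold wdir
  split_ifs with h1 h2 h3
  · norm_num
  · norm_num
  · obtain ⟨hn0, hf⟩ := h3
    exact raw_nonneg n c21 c41 c42 c43 v hn0 hf
  · exact le_refl 0

/-- Under the guard the weight is the table entry. -/
theorem wdir_eq_raw (n : ℚ) (c21 c41 c42 c43 v : ℕ) (hv1 : v ≠ 1) (hv2 : v ≠ 5) (hn0 : 10 ≤ n)
    (hf : (4 : ℚ) - c21 - c41 - 2 * c42 - 3 * c43 ≤ n - 10) : wdir n c21 c41 c42 c43 v = raw n c21 c41 c42 c43 v := by
  unfold wdir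
  rw [if_neg hv1, if_neg hv2, if_pos ⟨hn0, hf⟩]

/-- The pair member-column weight is `1/2`. -/
theorem wdir_mA (n : ℚ) (c21 c41 c42 c43 : ℕ) : wdir n c21 c41 c42 c43 1 = 1 / 2 := by
  unfold wdir
  rw [if_pos rfl]

/-- The quadruple member-column weight is `1/4`. -/
theorem wdir_mB (n : ℚ) (c21 c41 c42 c43 : ℕ) : wdir n c21 c41 c42 c43 5 = 1 / 4 := by
  unfold wdir
  rw [if_neg (by norm_num), if_pos rfl]

/-- The weight function of the lift: the class of the row type and the direction code, normalised by `#Y`. -/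
def W (n : ℚ) (a : Fin 3 → ℕ) (_c : ℕ) (d : Option (Fin 3)) : ℚ :=
  (d.elim (wdir n (cnt2 1 a) (cnt4 1 a) (cnt4 2 a) (cnt4 3 a) 6) (fun i => wdir n (cnt2 1 a) (cnt4 1 a) (cnt4 2 a) (cnt4 3 a) (code (sz i) (a i)))) / Yc n

/-- `W` at a free direction. -/
theorem W_none (n : ℚ) (a : Fin 3 → ℕ) (c : ℕ) : W n a c none = wdir n (cnt2 1 a) (cnt4 1 a) (cnt4 2 a) (cnt4 3 a) 6 / Yc n :=
  rfl

/-- `W` at a member direction. -/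
theorem W_some (n : ℚ) (a : Fin 3 → ℕ) (c : ℕ) (i : Fin 3) :
    W n a c (some i) = wdir n (cnt2 1 a) (cnt4 1 a) (cnt4 2 a) (cnt4 3 a) (code (sz i) (a i)) / Yc n :=
  rfl

/-- `W` is nonnegative (`n ≥ 5`). -/
theorem W_nonneg (n : ℚ) (hn : 5 ≤ n) (a : Fin 3 → ℕ) (c : ℕ) (d : Option (Fin 3)) : 0 ≤ W n a c d := by
  have hY := (Yc_pos n hn).le
  cases d
  · rw [W_none]; exact div_nonneg (wdir_nonneg _ _ _ _ _ _) hY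
  · rw [W_some]; exact div_nonneg (wdir_nonneg _ _ _ _ _ _) hY

end PercRepro.PuncturedLYM.Split.TypeLift.MixP1Q2
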